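import Mathlib
import Summits.Ventures.PercRepro2.Defs
import Summits.Ventures.PercRepro2.Graph
import Summits.Ventures.PercRepro2.Events
import Summits.Ventures.PercRepro2.Harris
import Summits.Ventures.PercRepro2.Induced
import Summits.Ventures.PercRepro2.BHK
import Summits.Ventures.PercRepro2.BHKEvents
import Summits.Ventures.PercRepro2.BHKAvoid

/-!
# Exploring the cluster of `a₃`: the inequality `β₂ ≥ β₅` (blind cell PercRepro2, mine-2 g12)

Four vertices `x a₂ a₃ b`. Let `N = {a₃ ↮ x, a₃ ↮ a₂}` (the cluster `D = C(a₃)` avoids `{x, a₂}`).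
THEOREM (`explore_a3_pattern_ineq`, MINE2-CUTVERTEX.md §13.15 (d) = piece (★b) of the root-far
lemma (L6)):

  `P(N, x ↔ a₂) · P(N, x ↮ a₂, b ↔ a₂) ≤ P(N, x ↮ a₂) · P(N, x ↔ a₂, b ↔ a₂)`,

i.e. `P(b ↔ a₂ | x ↔ a₂, a₃ apart from both) ≥ P(b ↔ a₂ | x, a₂, a₃ pairwise apart)`.

PROOF. Given `D`, the configuration on `G ∖ D` is product measure (domain Markov: the tower
identity `prob_clusterIn_inter_avoid_eq_expect`), so with the residual functionals
`g₁(D) = P_{G∖D}(x ↔ a₂)`, `g₂(D) = P_{G∖D}(b ↔ a₂)`, `g₁₂(D) = P_{G∖D}(x ↔ a₂, b ↔ a₂)`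
(`delClusterProb`) the target is `E[g₁ 1_N] · E[g₂ 1_N] ≤ P(N) · E[g₁₂ 1_N]`. Two steps:
* conditional Harris on `G ∖ D`: `g₁ g₂ ≤ g₁₂` pointwise (both events increasing on `G ∖ D`);
* `g₁, g₂` are antitone in `D` (`delClusterProb_anti`), so `1 − g₁, 1 − g₂` are nonnegative
  increasing cluster functionals and the functional BHK (`bhk_induced`, source `a₃`,
  avoided set `X = Y = {x, a₂}`) gives `E[g₁ 1_N] · E[g₂ 1_N] ≤ P(N) · E[g₁ g₂ 1_N]`.
-/

namespace Summit.Ventures.PercRepro2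
namespace ExploreA3

variable {V : Type*} {E : Type*} [Fintype E] [DecidableEq E] [Fintype V] [DecidableEq V]
  {R : Type*} [CommRing R] [LinearOrder R] [IsStrictOrderedRing R]

omit [Fintype E] [DecidableEq E] [Fintype V] [DecidableEq V] in
/-- Closing the edges around `W` is monotone in the configuration. -/
lemma delConfig_mono (ends : E → Sym2 V) (W : Set V) {ω ω' : Config E} (h : ω ≤ ω') :
    delConfig ends W ω ≤ delConfig ends W ω' := by
  intro e
  by_cases he : e ∈ touches ends W
  · simp [delConfig_apply_of_mem he]
  · simp only [delConfig_apply_of_notMem he]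
    exact h e

omit [Fintype E] [DecidableEq E] [Fintype V] [DecidableEq V] in
/-- `{C_t(G ∖ W) ∈ 𝓤}` is an increasing event for an up-set `𝓤`. -/
lemma isUpperSet_delCluster (ends : E → Sym2 V) (t : V) (W : Set V) {𝓤 : Set (Set V)}
    (h𝓤 : IsUpperSet 𝓤) :
    IsUpperSet {ω : Config E | cluster ends (delConfig ends W ω) t ∈ 𝓤} :=
  fun _ _ h hω => h𝓤 (cluster_mono (delConfig_mono ends W h) t) hω

omit [Fintype V] [DecidableEq V] in
/-- **Conditional Harris on `G ∖ W`**: for up-sets `𝓤, 𝓥`,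
`g_𝓤(W) · g_𝓥(W) ≤ g_{𝓤∩𝓥}(W)`. -/
lemma delClusterProb_mul_le (p : E → R) (hp : IsProbVec p) (ends : E → Sym2 V) (t : V)
    {𝓤 𝓥 : Set (Set V)} (h𝓤 : IsUpperSet 𝓤) (h𝓥 : IsUpperSet 𝓥) (W : Set V) :
    delClusterProb p ends t 𝓤 W * delClusterProb p ends t 𝓥 W ≤
      delClusterProb p ends t (𝓤 ∩ 𝓥) W := by
  unfold delClusterProb
  have h := prob_mul_prob_le_prob_inter hp (isUpperSet_delCluster ends t W h𝓤)
    (isUpperSet_delCluster ends t W h𝓥)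
  refine h.trans (le_of_eq ?_)
  rfl

omit [Fintype E] [DecidableEq E] [Fintype V] [DecidableEq V] in
/-- `{C(s) ∋ v}` is the connection event. -/
lemma clusterInEvent_mem_eq (ends : E → Sym2 V) (s v : V) :
    clusterInEvent ends s {W | v ∈ W} = connEvent ends s v := by
  ext ω
  simp only [mem_clusterInEvent, Set.mem_setOf_eq, cluster, mem_connEvent]

omit [Fintype E] [DecidableEq E] [Fintype V] [DecidableEq V] in
/-- `{C(s) ∋ v, C(s) ∋ w}` is the intersection of the two connection events. -/
lemma clusterInEvent_mem_inter_eq (ends : E → Sym2 V) (s v w : V) :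
    clusterInEvent ends s ({W | v ∈ W} ∩ {W | w ∈ W}) = connEvent ends s v ∩ connEvent ends s w := by
  ext ω
  simp only [mem_clusterInEvent, Set.mem_inter_iff, Set.mem_setOf_eq, cluster, mem_connEvent]

omit [Fintype E] [DecidableEq E] [Fintype V] [DecidableEq V] in
/-- The family of vertex sets containing `v` is an up-set. -/
lemma isUpperSet_mem (v : V) : IsUpperSet {W : Set V | v ∈ W} := fun _ _ h hW => h hW

/-- **THEOREM (β₂ ≥ β₅)**: `P(N, x↔a₂) · P(N, x↮a₂, b↔a₂) ≤ P(N, x↮a₂) · P(N, x↔a₂, b↔a₂)` with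
`N = {a₃ ↮ x, a₃ ↮ a₂}`. -/
theorem explore_a3_pattern_ineq (p : E → R) (hp : IsProbVec p) (ends : E → Sym2 V)
    (x a₂ a₃ b : V) :
    let N := avoidAll ends a₃ {x, a₂}
    let X₂ := connEvent ends a₂ x
    let Bv := connEvent ends a₂ b
    prob p (N ∩ X₂) * prob p (N ∩ X₂ᶜ ∩ Bv) ≤ prob p (N ∩ X₂ᶜ) * prob p (N ∩ X₂ ∩ Bv) := by
  intro N X₂ Bv
  have ha₂ : a₂ ∈ ({x, a₂} : Finset V) := by simp
  -- the residual functionals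
  set g₁ := delClusterProb p ends a₂ {W | x ∈ W} with hg₁
  set g₂ := delClusterProb p ends a₂ {W | b ∈ W} with hg₂
  set g₁₂ := delClusterProb p ends a₂ ({W | x ∈ W} ∩ {W | b ∈ W}) with hg₁₂
  -- tower identities
  have t₁ := prob_clusterIn_inter_avoid_eq_expect p ends a₃ a₂ ha₂ Set.univ {W | x ∈ W}
  have t₂ := prob_clusterIn_inter_avoid_eq_expect p ends a₃ a₂ ha₂ Set.univ {W | b ∈ W}
  have t₁₂ := prob_clusterIn_inter_avoid_eq_expect p ends a₃ a₂ ha₂ Set.univ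
    ({W | x ∈ W} ∩ {W | b ∈ W})
  simp only [Set.indicator_univ, Pi.one_apply, one_mul, clusterInEvent_mem_eq,
    clusterInEvent_mem_inter_eq] at t₁ t₂ t₁₂
  have eU : ∀ A : Set (Config E), clusterInEvent ends a₃ Set.univ ∩ A = A := by
    intro A; ext ω; simp only [Set.mem_inter_iff, mem_clusterInEvent, Set.mem_univ, true_and]
  rw [eU] at t₁ t₂ t₁₂
  -- conditional Harris, integrated
  have hpt : ∀ W, g₁ W * g₂ W ≤ g₁₂ W :=
    delClusterProb_mul_le p hp ends a₂ (isUpperSet_mem x) (isUpperSet_mem b)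
  have hE : expect p (fun ω => g₁ (cluster ends ω a₃) * g₂ (cluster ends ω a₃) *
      N.indicator 1 ω) ≤ prob p (X₂ ∩ Bv ∩ N) := by
    rw [t₁₂]
    refine expect_mono hp fun ω => ?_
    exact mul_le_mul_of_nonneg_right (hpt _) (Set.indicator_apply_nonneg fun _ => zero_le_one)
  -- the functional BHK for `1 − g₁`, `1 − g₂`
  have hg₁a : Antitone g₁ := delClusterProb_anti p hp ends a₂ (isUpperSet_mem x)
  have hg₂a : Antitone g₂ := delClusterProb_anti p hp ends a₂ (isUpperSet_mem b)
  have hg₁1 : ∀ W, g₁ W ≤ 1 := delClusterProb_le_one p hp ends a₂ _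
  have hg₂1 : ∀ W, g₂ W ≤ 1 := delClusterProb_le_one p hp ends a₂ _
  have hF₁ : Monotone (fun W => 1 - g₁ W) := fun W W' h => by
    simp only
    linarith [hg₁a h]
  have hF₂ : Monotone (fun W => 1 - g₂ W) := fun W W' h => by
    simp only
    linarith [hg₂a h]
  have hF₁0 : ∀ W, 0 ≤ 1 - g₁ W := fun W => by linarith [hg₁1 W]
  have hF₂0 : ∀ W, 0 ≤ 1 - g₂ W := fun W => by linarith [hg₂1 W]
  have key := bhk_induced p hp ends a₃ hF₁ hF₂ hF₁0 hF₂0 Finset.univ {x, a₂} {x, a₂}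
    (Finset.subset_univ _) (Finset.subset_univ _)
  simp only [Finset.inter_self, Finset.union_self, REvent_univ] at key
  have e : ∀ F : Set V → R, clusterObs ends Finset.univ a₃ F * (avoidAll ends a₃ {x, a₂}).indicator 1 =
      fun ω => F (cluster ends ω a₃) * (avoidAll ends a₃ {x, a₂}).indicator 1 ω := by
    intro F
    funext ω
    simp only [Pi.mul_apply, clusterObs_apply, clusterIn_univ]
  rw [e, e, e] at key
  simp only [Pi.mul_apply] at key
  -- rewrite the three expectations in terms of the masses and the product expectation
  have eN : prob p N = expect p fun ω => N.indicator 1 ω := prob_eq_expect_indicator p _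
  have e1 : expect p (fun ω => (1 - g₁ (cluster ends ω a₃)) * N.indicator 1 ω) =
      prob p N - prob p (X₂ ∩ N) := by
    rw [t₁, eN, ← expect_sub]
    congr 1
    funext ω
    simp only [Pi.sub_apply]
    ring
  have e2 : expect p (fun ω => (1 - g₂ (cluster ends ω a₃)) * N.indicator 1 ω) =
      prob p N - prob p (Bv ∩ N) := by
    rw [t₂, eN, ← expect_sub]
    congr 1
    funext ω
    simp only [Pi.sub_apply]
    ring
  have e12 : expect p (fun ω => (1 - g₁ (cluster ends ω a₃)) * (1 - g₂ (cluster ends ω a₃)) *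
      N.indicator 1 ω) = prob p N - prob p (X₂ ∩ N) - prob p (Bv ∩ N) +
      expect p (fun ω => g₁ (cluster ends ω a₃) * g₂ (cluster ends ω a₃) * N.indicator 1 ω) := by
    rw [t₁, t₂, eN, ← expect_sub, ← expect_sub, ← expect_add]
    congr 1
    funext ω
    simp only [Pi.sub_apply, Pi.add_apply]
    ring
  rw [e1, e2, e12] at key
  -- assemble: `G₁ G₂ ≤ n E[g₁ g₂ 1_N] ≤ n G₁₂`, then the target
  have hn0 : 0 ≤ prob p N := prob_nonneg hp _
  have hmain : prob p (X₂ ∩ N) * prob p (Bv ∩ N) ≤ prob p N * prob p (X₂ ∩ Bv ∩ N) := by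
    nlinarith [key, hE, hn0]
  -- the target in terms of the masses
  have c1 : prob p (N ∩ X₂) = prob p (X₂ ∩ N) := by rw [Set.inter_comm]
  have c2 : prob p (N ∩ X₂ᶜ) = prob p N - prob p (X₂ ∩ N) := by
    have := prob_inter_add_prob_inter_compl p N X₂
    rw [Set.inter_comm N X₂] at this
    linarith
  have c3 : prob p (N ∩ X₂ ∩ Bv) = prob p (X₂ ∩ Bv ∩ N) := by
    congr 1
    ext ω; simp only [Set.mem_inter_iff]; tauto
  have c4 : prob p (N ∩ X₂ᶜ ∩ Bv) = prob p (Bv ∩ N) - prob p (X₂ ∩ Bv ∩ N) := by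
    have := prob_inter_add_prob_inter_compl p (N ∩ Bv) X₂
    have e' : N ∩ Bv ∩ X₂ = X₂ ∩ Bv ∩ N := by ext ω; simp only [Set.mem_inter_iff]; tauto
    have e'' : N ∩ Bv ∩ X₂ᶜ = N ∩ X₂ᶜ ∩ Bv := by ext ω; simp only [Set.mem_inter_iff]; tauto
    rw [e', e'', Set.inter_comm N Bv] at this
    linarith
  rw [c1, c2, c3, c4]
  nlinarith [hmain]

end ExploreA3
end Summit.Ventures.PercRepro2
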